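import Mathlib
import HarnessLib
import Literature.MathematicalPhysics.StatisticalMechanics.LinearisedMapNorm
import Literature.MathematicalPhysics.StatisticalMechanics.LinearisedMapSingleBlockRay

/-!
# Lemma 10.1 of [ABKM19] in norm form WITHOUT locality of the weights:
# `‖C^{(q)} K‖_{k+1}^{(A)} ≤ (L^d c'_G + ε(A)) ‖K‖_k^{(A)}`

`LinearisedMapBlockTerm.tayNormLE_blockTerm` and `LinearisedMapNorm.weakNormLE_opC` carry the
hypotheses `P.W.Local nb` and `nb k X ⊆ X*` (the weight `w_{k:k+1}^B` gauge-local on `B*`), which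
the [ABKM19] weight tower does not satisfy (`w_k^X` lives on `X^{++} ⊋ X*`, Lemma 7.5 (iii)).
Using the ray form of Lemma 10.3/10.4 (`LinearisedMapSingleBlockRay`, the weight is only
evaluated at the fields `tφ`, as in the source's (10.12)) we re-derive both statements without
them; everything else (hypotheses, constants, conclusions) is verbatim:

* **`tayNormLE_blockTerm_of_ray`** — Lemmas 10.3–10.4 per block in norm form;
* **`weakNormLE_opC_of_ray`** — Lemma 10.1 in norm form:
  `WeakNormLE P k K C → WeakNormLE P (k+1) (opC D K) (C · (L^d · 1536 κ c_G + ε(A)))`.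

Everything here is proved; no named fact.

## References
* S. Adams, S. Buchholz, R. Kotecký, S. Müller, arXiv:1910.13564, Lemma 10.1 (and 10.2–10.4, 8.1,
  8.4, Theorem 7.1 (w6), (w7), (w9)) [AdamsBuchholzKoteckyMuller2019].
-/

noncomputable section

namespace Literature.MathematicalPhysics.StatisticalMechanics.GradientRG

open scoped BigOperators Classical
open Finset
open Literature.MathematicalPhysics.StatisticalMechanics.TorusPolymer
  (IsPolymer blocks numBlocks closure reblock blockOf thicken mem_blocks mem_blockOf blockOf_eq_of_mem
    mem_blockOf_self isPolymer_blockOf blocks_blockOf card_blocks_eq_numBlocks boxCorner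
    blockCenter subset_thicken thicken_mono thicken_mono_rad)
open Literature.Barriers.CriticalPhenomena.LongRangePhi4.Polymer (IsConn)
open Literature.MathematicalPhysics.QuantumFieldTheory

variable {d M : ℕ} [NeZero M]

/-- **Lemmas 10.3–10.4 for the block terms (norm form), no locality of the weights.**  Let `D` be
the step data of scale `k` with reference block `B₀ = B_{x₀}` and base point the corner of `B₀*`;
`‖K‖_k^{(A)} ≤ C`, `K` translation invariant, local and `C^{r₀}` with `C^{r₀}` fluctuation
integrals; the integration property with constant `κ`; weights dominated and monotone; the gauge
relations of two consecutive scales and the no-wrap/room conditions for the box `B*`; and (w9) at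
`U`.  Then every `k`-block `B` with `B̄ = U` satisfies
`|G(B)|_{k+1,U,T_φ} ≤ C (1536 κ c_G) A^{−1} w_{k+1}^U(φ)`. [cite: AdamsBuchholzKoteckyMuller2019, Lemma 10.4 (10.13)] -/
theorem tayNormLE_blockTerm_of_ray (P : NormParams d M) {k t : ℕ} (hM : M = P.L ^ (k + 1) * t)
    (hL : Odd P.L) (ht : Odd t) (D : StepData d M) (hDs : D.s = P.L ^ k)
    {x₀ : Fin d → ZMod M} (hB₀ : D.B₀ = blockOf (P.L ^ k) x₀)
    (hc₀ : D.c₀ = boxCorner (P.L ^ k) (P.rad k) x₀) (hC𝒞 : (Matrix.circulant D.𝒞).PosSemidef)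
    -- gauges of the two scales
    (h𝔥 : 0 < P.𝔥 (k + 1)) (h𝔥le : P.𝔥 (k + 1) ≤ P.𝔥 k) {κ₁ : ℝ} (hκ₁ : P.𝔥 (k + 1) ≤ κ₁ * P.𝔥 k)
    (hR : 0 < P.R k) (hRsucc : P.R (k + 1) = P.L * P.R k) (hθ : P.𝔥 (k + 1) / P.𝔥 k * (P.R k / P.R (k + 1)) ≤ 1)
    (hp : d / 2 + 2 ≤ P.p) (hr₀ : 3 ≤ P.r₀) (hrad : P.rad k ≤ P.rad (k + 1))
    -- the box `B*`
    (hwrap : 4 * ((P.L ^ k - 1) / 2 + P.rad k) < M)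
    (hroom : ((2 * ((P.L ^ k - 1) / 2 + P.rad k) : ℕ) + (P.p : ℤ)) * 2 < M)
    {C₁ C₀ : ℝ} (hC₁ : 0 ≤ C₁) (hρ : ((2 * ((P.L ^ k - 1) / 2 + P.rad k) : ℕ) : ℝ) ≤ C₁ * P.R k)
    (hC₀ : 1 ≤ C₀) (hρ0 : ((2 * ((P.L ^ k - 1) / 2 + P.rad k) : ℕ) : ℝ) + (d / 2 + 1 : ℕ) ≤ C₀ * P.R k)
    -- weights
    {Dm : ℕ → Matrix (Fin d → ZMod M) (Fin d → ZMod M) ℝ} (hWd : P.W.Dominated Dm) (hWm : P.W.Monotone)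
    -- the activity
    {𝒦κ : ℝ} (hκ : 0 ≤ 𝒦κ) (hint : IntegrationProperty P k D.𝒞 𝒦κ)
    {K : Finset (Fin d → ZMod M) → ((Fin d → ZMod M) → ℝ) → ℂ} {C : ℝ} (hC : 0 ≤ C)
    (hK : WeakNormLE P k K C) (hKt : TransInv D.s K) (hKd : ∀ X, ContDiff ℝ P.r₀ (K X))
    (hKloc : ∀ X, IsPolymer (P.L ^ k) X → IsConn X → IsGaugeLocal (P.gauge k X) (K X))
    (hRd : ∀ X, ContDiff ℝ P.r₀ (fluct D.𝒞 (K X))) (hA : 1 ≤ P.A)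
    {U : Finset (Fin d → ZMod M)} (hw9 : W9At P k U)
    {B : Finset (Fin d → ZMod M)} (hB : B ∈ blockPartIndex D U) :
    TayNormLE (P.gauge (k + 1) U) P.r₀ (P.W.weight (k + 1) U) (blockTerm D K B)
      (C * (1536 * 𝒦κ * blockContrConst d (P.𝔥 k) (P.𝔥 (k + 1)) (P.R k) (P.R (k + 1)) P.L κ₁ C₁ C₀) * P.A⁻¹) := by
  -- scales and the torus
  set s := P.L ^ k with hsdef
  have hsodd : Odd s := hL.pow
  have hLs : P.L * s = P.L ^ (k + 1) := (pow_succ' P.L k).symm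
  have hMs : M = s * (P.L * t) := hM.trans (by rw [pow_succ]; ring)
  have hLt : Odd (P.L * t) := hL.mul ht
  have hMo : Odd M := by rw [hMs]; exact hsodd.mul hLt
  have hA0 : 0 < P.A := by linarith
  have h𝔥k : 0 < P.𝔥 k := h𝔥.trans_le h𝔥le
  have hR' : 0 < P.R (k + 1) := by rw [hRsucc]; exact mul_pos (by exact_mod_cast hL.pos) hR
  have hp1 : 1 ≤ P.p := by omega
  -- the block `B = B_y`, `U = B̄`
  obtain ⟨hBbl, hcl⟩ := mem_filter.1 hB
  obtain ⟨y, -, rfl⟩ := mem_blocks.1 hBbl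
  rw [hDs] at hcl ⊢
  have hBU : blockOf s y ⊆ U := by rw [← hcl]; exact TorusPolymer.subset_closure _ _
  -- `B` as a translate of `B₀`, and the box data of `B*`
  set v := blockCenter s y - blockCenter s x₀ with hv
  have hvlat : TorusPolymer.IsLatticeVec D.s v := by
    rw [hDs]; exact TorusPolymer.isLatticeVec_blockCenter_sub s y x₀
  have hBtr : blockOf s y = TorusPolymer.translate v D.B₀ := by
    rw [hB₀]; exact blockOf_eq_translate_blockCenter_sub hMs hsodd hLt x₀ y
  set a := boxCorner s (P.rad k) y with ha
  have hac : D.c₀ + v = a := by rw [hc₀, ha, hv, TorusPolymer.boxCorner_eq_add s (P.rad k) x₀ y]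
  set S := thicken (P.rad k) (blockOf s y) with hSdef
  set ρ' : ℕ := 2 * ((s - 1) / 2 + P.rad k) with hρ'
  have hS : ∀ x, x ∈ S ↔ InBox a ρ' x := fun x =>
    TorusPolymer.mem_thicken_blockOf_iff_inBox hMs hsodd hLt hwrap y x
  have haa : InBox a ρ' a := TorusPolymer.inBox_self a ρ'
  have hroomS : ∀ x ∈ S, HasRoom a x P.p := fun x hx =>
    TorusPolymer.hasRoom_of_inBox ((hS x).1 hx) hroom
  have hBS : blockOf s y ⊆ S := subset_thicken _ _
  have hBne : (blockOf s y).card ≠ 0 := (card_pos.2 ⟨y, mem_blockOf_self s y⟩).ne'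
  -- the block term is the `Π₂`-remainder at `B` of `F = R K(B)`
  have hGeq : blockTerm D K (blockOf s y) = Pi2Rem a (blockOf s y) (fluct D.𝒞 (K (blockOf s y))) := by
    rw [hBtr, blockTerm_eq_Pi2Rem D hC𝒞 hKt hvlat, hac]
  set F := fluct D.𝒞 (K (blockOf s y)) with hF
  -- `F` is local and `C^{r₀}`, and `|F|_{T_ψ} ≤ C κ A^{-1} w_{k:k+1}^B(ψ)` (norm of `K` + Lemma 8.4)
  have hPB : IsPolymer (P.L ^ k) (blockOf s y) := isPolymer_blockOf _ y
  have hcB : IsConn (blockOf s y) := TorusPolymer.isConn_blockOf hMo hsodd y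
  have hgauge : P.gauge k (blockOf s y) = fieldGauge (P.𝔥 k) (P.R k) P.p S := rfl
  have hlocK : IsGaugeLocal (fieldGauge (P.𝔥 k) (P.R k) P.p S) (K (blockOf s y)) := hKloc _ hPB hcB
  have hlocF : IsGaugeLocal (fieldGauge (P.𝔥 k) (P.R k) P.p S) F :=
    isGaugeLocal_integral _ (stepMeasure D.𝒞) fun ξ => hlocK.comp_add_right _ ξ
  have hnB : numBlocks (P.L ^ k) (blockOf s y) = 1 := by
    rw [← card_blocks_eq_numBlocks, blocks_blockOf, card_singleton]
  have hFw : ∀ ψ, tayNorm (fieldGauge (P.𝔥 k) (P.R k) P.p S) P.r₀ F ψ ≤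
      C * P.A⁻¹ * 𝒦κ * P.W.midWeight k (blockOf s y) ψ := by
    have h1 := hint _ hPB hcB (K (blockOf s y)) (C * P.aFactor k (blockOf s y))
      (mul_nonneg hC (WeakNormLE.aFactor_pos hA0 k _).le) (hKd _) (hgauge ▸ hlocK) (hK _ hPB hcB)
    intro ψ
    have := h1 ψ
    rw [hnB, pow_one, NormParams.aFactor, hnB, pow_one] at this
    exact this
  -- the weight `w_{k:k+1}^B` as regulator (evaluated along rays only), and (w9) on `U* ⊇ B*`
  have hw1 : ∀ ψ, 1 ≤ P.W.midWeight k (blockOf s y) ψ := WeightData.one_le_midWeight hWd k _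
  have hSS' : S ⊆ thicken (P.rad (k + 1)) U :=
    (thicken_mono _ hBU).trans (thicken_mono_rad hrad U)
  have hw9' : ∀ φ, Real.exp (‖fieldGauge (P.𝔥 (k + 1)) (P.R (k + 1)) P.p (thicken (P.rad (k + 1)) U) φ‖ ^ 2 / 2)
      * P.W.midWeight k (blockOf s y) φ ≤ P.W.weight (k + 1) U φ := fun φ =>
    (mul_le_mul_of_nonneg_left (WeightData.midWeight_mono hWd hWm k hBU φ) (Real.exp_pos _).le).trans
      (hw9 φ)
  -- Lemma 10.3 (ray form) + (w9)
  have hmain := tayNormLE_Pi2Rem_of_w9_of_ray (𝕜 := ℂ) hS haa hroomS hp hBS hBne h𝔥k h𝔥 hR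
    (by exact_mod_cast hL.pos : (1 : ℝ) ≤ P.L) hRsucc hκ₁ h𝔥le hC₁ hρ hC₀ hρ0 hθ hr₀ (hRd _) hlocF
    hw1 (WeightData.midWeight_zero k _) (fun ψ t ht => WeightData.midWeight_smul_le hWd k _ ψ ht)
    (by positivity : 0 ≤ C * P.A⁻¹ * 𝒦κ) hFw hSS' hw9'
  rw [hGeq]
  intro φ
  refine (hmain φ).trans (le_of_eq ?_)
  show _ = C * (1536 * 𝒦κ * blockContrConst d (P.𝔥 k) (P.𝔥 (k + 1)) (P.R k) (P.R (k + 1)) P.L κ₁ C₁ C₀) *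
    P.A⁻¹ * P.W.weight (k + 1) U φ
  ring

/-- **Lemma 10.1 (norm form), no locality of the weights:
`‖C^{(q)}K‖_{k+1}^{(A)} ≤ (L^d c'_G + ε(A)) ‖K‖_k^{(A)}`.**  Verbatim `weakNormLE_opC` without the
hypotheses `P.W.Local nb`, `nb k X ⊆ X*`. [cite: AdamsBuchholzKoteckyMuller2019, Lemma 10.1] -/
theorem weakNormLE_opC_of_ray (P : NormParams d M) {k t : ℕ} (hM : M = P.L ^ (k + 1) * t)
    (hL : Odd P.L) (ht : Odd t) (D : StepData d M) (hDs : D.s = P.L ^ k) (hDL : D.L = P.L)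
    {x₀ : Fin d → ZMod M} (hB₀ : D.B₀ = blockOf (P.L ^ k) x₀)
    (hc₀ : D.c₀ = boxCorner (P.L ^ k) (P.rad k) x₀) (hC𝒞 : (Matrix.circulant D.𝒞).PosSemidef)
    -- gauges of the two scales
    (h𝔥 : 0 < P.𝔥 (k + 1)) (h𝔥le : P.𝔥 (k + 1) ≤ P.𝔥 k) {κ₁ : ℝ} (hκ₁ : P.𝔥 (k + 1) ≤ κ₁ * P.𝔥 k)
    (hR : 0 < P.R k) (hRsucc : P.R (k + 1) = P.L * P.R k)
    (hθ : P.𝔥 (k + 1) / P.𝔥 k * (P.R k / P.R (k + 1)) ≤ 1)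
    (hp : d / 2 + 2 ≤ P.p) (hr₀ : 3 ≤ P.r₀) (hrad : P.rad k ≤ P.rad (k + 1))
    (hrad' : P.rad k + (2 ^ d - 1) * P.L ^ k ≤ P.rad (k + 1))
    -- the box `B*`
    (hwrap : 4 * ((P.L ^ k - 1) / 2 + P.rad k) < M)
    (hroom : ((2 * ((P.L ^ k - 1) / 2 + P.rad k) : ℕ) + (P.p : ℤ)) * 2 < M)
    {C₁ C₀ : ℝ} (hC₁ : 0 ≤ C₁) (hρ : ((2 * ((P.L ^ k - 1) / 2 + P.rad k) : ℕ) : ℝ) ≤ C₁ * P.R k)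
    (hC₀ : 1 ≤ C₀) (hρ0 : ((2 * ((P.L ^ k - 1) / 2 + P.rad k) : ℕ) : ℝ) + (d / 2 + 1 : ℕ) ≤ C₀ * P.R k)
    -- weights
    {Dm : ℕ → Matrix (Fin d → ZMod M) (Fin d → ZMod M) ℝ} (hWd : P.W.Dominated Dm) (hWm : P.W.Monotone)
    (hw6 : NextWeightDominates P k) (hw9 : ∀ U, IsPolymer (P.L ^ (k + 1)) U → W9At P k U)
    -- integration property, large-set parameter, gain
    {κ η : ℝ} (hκ : 0 ≤ κ) (hκA : κ ≤ P.A) (hA : 1 ≤ P.A) (hη : 0 < η)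
    (hint : IntegrationProperty P k D.𝒞 κ)
    (hsmall : (2 : ℝ) ^ (P.L ^ d) * (κ * P.A ^ (-(1 - η⁻¹) : ℝ)) ≤ 1)
    (hgain : ∀ X : Finset (Fin d → ZMod M), IsPolymer (P.L ^ k) X → IsConn X →
      2 ^ d < (blocks (P.L ^ k) X).card →
        η * ((blocks (P.L * P.L ^ k) (closure (P.L * P.L ^ k) X)).card : ℝ) ≤ (blocks (P.L ^ k) X).card)
    -- the activity
    {K : Finset (Fin d → ZMod M) → ((Fin d → ZMod M) → ℝ) → ℂ} {C : ℝ} (hC : 0 ≤ C)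
    (hK : WeakNormLE P k K C) (hKt : TransInv D.s K) (hKd : ∀ X, ContDiff ℝ P.r₀ (K X))
    (hKloc : ∀ X, IsPolymer (P.L ^ k) X → IsConn X → IsGaugeLocal (P.gauge k X) (K X))
    (hRd : ∀ X, ContDiff ℝ P.r₀ (fluct D.𝒞 (K X))) :
    WeakNormLE P (k + 1) (opC D K)
      (C * ((P.L : ℝ) ^ d * (1536 * κ * blockContrConst d (P.𝔥 k) (P.𝔥 (k + 1)) (P.R k) (P.R (k + 1))
        P.L κ₁ C₁ C₀) + largePartEps d P.L P.A κ η)) := by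
  intro U hU hcU
  have hLs : P.L * P.L ^ k = P.L ^ (k + 1) := (pow_succ' P.L k).symm
  have hLDs : D.L * D.s = P.L ^ (k + 1) := by rw [hDL, hDs, hLs]
  have hM' : M = D.L * D.s * t := hM.trans (by rw [hLDs])
  have hRle : P.R k ≤ P.R (k + 1) := by
    rw [hRsucc]
    have h1 : (1 : ℝ) ≤ P.L := by exact_mod_cast hL.pos
    nlinarith
  set cG := 1536 * κ * blockContrConst d (P.𝔥 k) (P.𝔥 (k + 1)) (P.R k) (P.R (k + 1)) P.L κ₁ C₁ C₀
    with hcG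
  -- the per-block bounds (Lemmas 10.3–10.4, ray form)
  have hG : ∀ B ∈ blockPartIndex D U, TayNormLE (P.gauge (k + 1) U) P.r₀ (P.W.weight (k + 1) U)
      (blockTerm D K B) (C * cG * P.A⁻¹) := fun B hB =>
    tayNormLE_blockTerm_of_ray P hM hL ht D hDs hB₀ hc₀ hC𝒞 h𝔥 h𝔥le hκ₁ hR hRsucc hθ hp hr₀ hrad
      hwrap hroom hC₁ hρ hC₀ hρ0 hWd hWm hκ hint hC hK hKt hKd hKloc hRd hA (hw9 U hU) hB
  have hκ₁0 : 0 ≤ κ₁ := ((mul_pos_iff_of_pos_right (h𝔥.trans_le h𝔥le)).1 (h𝔥.trans_le hκ₁)).le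
  have hcG0 : 0 ≤ cG := by
    have := blockContrConst_nonneg d (h𝔥.trans_le h𝔥le) h𝔥.le hR.le (hR.trans_le hRle)
      (show (0 : ℝ) < (P.L : ℝ) by exact_mod_cast hL.pos) hκ₁0 hC₁ (show (0 : ℝ) ≤ C₀ by linarith)
    rw [hcG]; positivity
  -- the per-polymer bounds (Lemma 8.4 + 8.1 + (w6))
  have hRb : ∀ X ∈ largePartIndex D.s D.L U, TayNormLE (P.gauge (k + 1) U) P.r₀ (P.W.weight (k + 1) U)
      (fluct D.𝒞 (K X)) (C * (κ ^ (blocks D.s X).card * (P.A ^ (blocks D.s X).card)⁻¹)) := by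
    intro X hX
    obtain ⟨hPX, hcX, -, hr⟩ := mem_largePartIndex.1 hX
    rw [hDs] at hPX hr ⊢
    rw [hDL] at hr
    rw [← hr]
    exact tayNormLE_fluct_at_reblock P hM hL ht h𝔥 h𝔥le hR hRle hrad hrad' hA hκ hint hw6 hC hK hKd
      hKloc hRd hPX hcX
  have hmain := tayNormLE_opC D hM' (hDs ▸ hL.pow) (hDL ▸ hL) ht (P.gauge (k + 1) U)
    (w := P.W.weight (k + 1) U) (fun φ => (P.W.weight_pos (k + 1) U φ).le) (K := K) hA hκ hκA hη hC
    hcG0 (by rwa [hDL]) (by rw [hDs, hDL]; exact hgain) (by rwa [hLDs]) hcU.1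
    (fun B _ => contDiff_blockTerm D hRd B) hG (fun X _ => hRd X) hRb
  refine hmain.mono (le_of_eq ?_) fun φ => (P.W.weight_pos (k + 1) U φ).le
  rw [NormParams.aFactor, ← card_blocks_eq_numBlocks, hLDs, hDL]

end Literature.MathematicalPhysics.StatisticalMechanics.GradientRG

end
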